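import Mathlib
import HarnessLib
import Summits.HubbardSuperconductivity.HubbardSuperconductivity.Theorems.KLProgrammeKLRegimeEngineV17F2RowCFirstStep
import Summits.HubbardSuperconductivity.HubbardSuperconductivity.Theorems.KLProgrammeKLRegimeCountertermJacksonRemainderReadResidueC1TabFitB
import Summits.HubbardSuperconductivity.HubbardSuperconductivity.Theorems.KLProgrammeKLRegimeCountertermJacksonRemainderReadResidueC1TabFitC
import Summits.HubbardSuperconductivity.HubbardSuperconductivity.Theorems.KLProgrammeKLRegimeCountertermJacksonRemainderCertAnFitDefs

/-!
# Route `KLProgramme` — ENGINE item stmt-HubbardSuperconductivity-20437 `KLRegimeEngineV17F2`, ROW (C) `stub_twoLeg_curvature` — «(C)-FIRST-STEP-FIT»,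
# the cure's screen IN THE #22a/#22b RECORD CURRENCY and ACROSS ALL SCALES (cell gate-hubbard-kl, seat p2 g29; memo `HOME/p2-g29/W4-NEAR-RECORDS-SCREEN.md`)

WHY.  The vacuity screen of the re-keyed (C) package `hres‴` (✓ `firstStep_dedicated_table128r_feasible`, …EngineV17F2RowCFirstStep §3, p2 g28) certifies
that the first step's rows are satisfiable for every DEDICATED scale-`0` table in the box `c0 ≤ (·, 0.1, 1, 4, 224)`.  In the records' own currency
(`c0 = cD(B, sS) = (5, 3.19·B₁ + δ_A, 3.19²·B₂ + 24.12·B₁ + δ_A, sS₃ + δ_A, sS₄ + δ_A)`, …ScaleZeroRecordPairDedicated, with `B₁, B₂` the #22a sunset-moment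
BUDGETS `bS 1, bS 2` and `sS₃, sS₄` the #22b on-curve jets) that box is EMPTY on the `k = 2` coordinate: the #22a SPEC targets `(bS₁, bS₂) = (0.16, 1.0)` give
`cD 2 = 14.04`, and the one CERTIFIED near record (the (a1) sub-disk pilot at `μ*`, rows `(0.022758, 0.043586, 0.385974)`) alone forces `cD 2 ≥ 4.98 > 1`.
This file re-runs the screen on boxes the records CAN enter — `c0 2 ≤ 16`, `c0 3 ≤ 16`, `c0 4 ≤ 2048`, i.e. the #22a/#22b FIT CEILINGS of
✓ `twoLegRead_frameZero_registered_klEngGQ_of_chain_certA` (`= klC4aJetC2 2/3/4`) — and upgrades p2 g28's «numeric, not kernel» parenthetical to the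
kernel: ONE explicit private table `cc⋆ = (·, 8, 16, 16, 2048)` satisfies, besides the `m = 0` block on `c0`, the (C1) table-row families of `hres‴` at the
reading scales `m = 1 … 4` (records `klC1TableF512/2048/8192/32768`, shapes of k3c3-p1's `klC1TableF<d>_eJ_le` = `hres‴` row l.109 at `m ↦ 1 … 4`) and the
deep analytic rows (`klC1AnFit cc⋆`, `5 ≤ m`), each with its private fit `cA m k + (FIT k·U₀ + eJ m k) ≤ cc k` (FIT share abstracted as `t k ≤ 2⁻¹⁰`,
✓ …EngineV17F2RowCFitRooms), the dominations `c0 k ≤ cc k` and the ceilings `cc k ≤ klC4aJetC2 k` (`k = 1 … 4`).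
* `firstStep_dedicated_allScales_feasible_of_rows` — ROW FORM: feasible at `cc⋆` as soon as the four first-step affine rows
  `cA 0 k + 2⁻¹⁰ + (S⁽¹²⁸ʳ⁾·c0) k ≤ cc⋆ k` hold and every slice row is `≤ (6, 9.1, 3, 220)` (C4A-PLAN's sizes; the honest signed ones are ≈ 100× smaller);
* `firstStep_dedicated_allScales_feasible_recordBox` — BOX FORM, everything else AT ITS CEILING: `c0 ≤ (·, 0.18, 16, 16, 2048)`, slices `≤ (6, 9.1, 3, 220)`
  ⇒ feasible, i.e. **`B₁ ≤ (0.18 − δ_A)/3.19 = 0.0564` suffices unconditionally in `(B₂, sS₃, sS₄)`**;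
* `firstStep_dedicated_allScales_feasible_recordBox_signedA` — the same with the `k = 3` slice at the honest signed size `≤ 0.25` ((R559)/(R561),
  architecture (γ)): `c0 1 ≤ 0.24` ⇔ **`B₁ ≤ 0.0752`**.
The binding row is `k = 3` at `m = 0` (`45.82·c0 1`, the `d = 128` record's cutoff-defect moment `N 3 = 114.2` through the mean-free proxy `a 0 = (π/2)·a 1`);
at the #22a SPEC target `bS₁ = 0.16` (`c0 1 = 0.51`) that row reads `≥ 23.4 > 16` for EVERY slice row, so a W4 production run TO SPEC would not close the
first step: the W4 `k = 1` target has to be re-set to `≈ 0.075` (C4A sizes) / `≈ 0.095` (signed sizes, small `sS`) — float truth at `μ*` ≈ `0.054–0.067`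
(memo §3).  Pure arithmetic on landed numerals; `hres‴`, the records and the slices are HYPOTHESES of other seats; nothing here asserts or refutes row (C),
any registered row, K3, U₀, the window, a margin or superconductivity in the Hubbard model.  0 kit · 0 lit.
References: BGM 2006 §2.4 Lemma 2.1 (2.36)–(2.42) [cite: BenfattoGiulianiMastropietro2006].
-/

noncomputable section

namespace Summit.HubbardSuperconductivity.HubbardSuperconductivity.Theorems.EngineV8

set_option linter.dupNamespace false -- summit = problem name (single-conjunct summit), D-0017

open Real
open Summit.HubbardSuperconductivity.HubbardSuperconductivity.Theorems.KLRegimeSplit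

/-! ## §1 Row form: the whole (C1)/(C2) fit block of `hres‴` at the explicit private table `cc⋆ = (·, 8, 16, 16, 2048)` -/
set_option maxHeartbeats 400000 in
/-- **«(C)-FIRST-STEP-FIT» — THE RE-KEYED PACKAGE'S FIT BLOCK IS SATISFIABLE ACROSS ALL SCALES, ROW FORM.**  Data: a dedicated scale-`0` table
`c0 ≥ 0` below the #22a/#22b fit ceilings (`c0 1 ≤ 8`, `c0 2 ≤ 16`, `c0 3 ≤ 16`, `c0 4 ≤ 2048`), slice rows `cA m k` with `cA m ≤ (6, 9.1, 3, 220)` at every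
scale, transport shares `t k ≤ 2⁻¹⁰`, and the four FIRST-STEP affine rows `cA 0 k + 2⁻¹⁰ + (S⁽¹²⁸ʳ⁾·c0) k ≤ (8, 16, 16, 2048)_k`.  Conclusion: with
`cc⋆ := (·, 8, 16, 16, 2048)` and an explicit `eJ`, (i) the `m = 0` (C1) table row of `hres‴` on `c0` (`Tc 0 := klC1TableF128r`, VERBATIM shape),
(ii) the `m = 1, 2, 3, 4` (C1) table rows on `cc⋆` (`Tc m := klC1TableF512 / 2048 / 8192 / 32768`, shape of `hres‴` row l.109 at `m ↦ 1 … 4`),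
(iii) the private fits `cA m k + (t k + eJ m k) ≤ cc⋆ k` for `m ≤ 4`, (iv) the deep fits `cA m k + (t k + klC1AnFit cc⋆ k) ≤ cc⋆ k` for `5 ≤ m`,
(v) `c0 k ≤ cc⋆ k ≤ klC4aJetC2 k`, all for `k = 1 … 4`. [cite: BenfattoGiulianiMastropietro2006, §2.4 Lemma 2.1 (2.36)–(2.42)] -/
theorem firstStep_dedicated_allScales_feasible_of_rows {c0 t : ℕ → ℝ} {cA : ℕ → ℕ → ℝ} (hc0 : ∀ l, 0 ≤ c0 l)
    (hc01 : c0 1 ≤ 8) (hc02 : c0 2 ≤ 16) (hc03 : c0 3 ≤ 16) (hc04 : c0 4 ≤ 2048)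
    (ha : ∀ m, cA m 1 ≤ 6 ∧ cA m 2 ≤ 9.1 ∧ cA m 3 ≤ 3 ∧ cA m 4 ≤ 220) (ht' : ∀ k, t k ≤ 1 / 2 ^ 10)
    (h1 : cA 0 1 + 1 / 2 ^ 10 + (0.8105 * c0 1 + 0.02273 * c0 2) ≤ 8)
    (h2 : cA 0 2 + 1 / 2 ^ 10 + (2.061 * c0 1 + 0.04792 * c0 2 + 0.005681 * c0 3) ≤ 16)
    (h3 : cA 0 3 + 1 / 2 ^ 10 + (45.82 * c0 1 + 0.09241 * c0 2 + 0.01341 * c0 3 + 0.001421 * c0 4) ≤ 16)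
    (h4 : cA 0 4 + 1 / 2 ^ 10 + (5928 * c0 1 + 0.4898 * c0 2 + 0.03347 * c0 3 + 0.1289 * c0 4) ≤ 2048) :
    ∃ cc : ℕ → ℝ, ∃ eJ : ℕ → ℕ → ℝ, (∀ l, 0 ≤ cc l) ∧ (∀ m, eJ m 0 = 0) ∧
      -- (i) m = 0: the (C1) table row on the DEDICATED table `c0` (hres‴ l.123, `Tc 0 := klC1TableF128r`)
      (∀ k ≤ 4,
            (fun k => if k = 0 then 0 else
              (if k ≤ 3 then klC1TableF128r.bound (fun l : ℕ => if l = 0 then π / 2 * c0 1 * (4 : ℝ) ^ ((((1 : ℕ) : ℤ) - 2) * ((0 : ℕ) : ℤ)) else c0 l * (4 : ℝ) ^ (((l : ℤ) - 2) * ((0 : ℕ) : ℤ))) k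
                else klC1TableF128r.boundNR (fun l : ℕ => if l = 0 then π / 2 * c0 1 * (4 : ℝ) ^ ((((1 : ℕ) : ℤ) - 2) * ((0 : ℕ) : ℤ)) else c0 l * (4 : ℝ) ^ (((l : ℤ) - 2) * ((0 : ℕ) : ℤ))) k) *
                ((4 : ℝ) ^ (((k : ℤ) - 2) * ((0 + 1 : ℕ) : ℤ)))⁻¹) k ≤ eJ 0 k) ∧
      -- (ii) m = 1 … 4: the (C1) table rows on the PRIVATE table (hres‴ l.109 at m ↦ 1, 2, 3, 4; `Tc m := klC1TableF512 / 2048 / 8192 / 32768`)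
      (∀ k ≤ 4,
            (fun k => if k = 0 then 0 else
              (if k ≤ 3 then klC1TableF512.bound (fun l : ℕ => if l = 0 then π / 2 * cc 1 * (4 : ℝ) ^ ((((1 : ℕ) : ℤ) - 2) * ((1 : ℕ) : ℤ)) else cc l * (4 : ℝ) ^ (((l : ℤ) - 2) * ((1 : ℕ) : ℤ))) k
                else klC1TableF512.boundNR (fun l : ℕ => if l = 0 then π / 2 * cc 1 * (4 : ℝ) ^ ((((1 : ℕ) : ℤ) - 2) * ((1 : ℕ) : ℤ)) else cc l * (4 : ℝ) ^ (((l : ℤ) - 2) * ((1 : ℕ) : ℤ))) k) *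
                ((4 : ℝ) ^ (((k : ℤ) - 2) * ((1 + 1 : ℕ) : ℤ)))⁻¹) k ≤ eJ 1 k) ∧
      (∀ k ≤ 4,
            (fun k => if k = 0 then 0 else
              (if k ≤ 3 then klC1TableF2048.bound (fun l : ℕ => if l = 0 then π / 2 * cc 1 * (4 : ℝ) ^ ((((1 : ℕ) : ℤ) - 2) * ((2 : ℕ) : ℤ)) else cc l * (4 : ℝ) ^ (((l : ℤ) - 2) * ((2 : ℕ) : ℤ))) k
                else klC1TableF2048.boundNR (fun l : ℕ => if l = 0 then π / 2 * cc 1 * (4 : ℝ) ^ ((((1 : ℕ) : ℤ) - 2) * ((2 : ℕ) : ℤ)) else cc l * (4 : ℝ) ^ (((l : ℤ) - 2) * ((2 : ℕ) : ℤ))) k) *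
                ((4 : ℝ) ^ (((k : ℤ) - 2) * ((2 + 1 : ℕ) : ℤ)))⁻¹) k ≤ eJ 2 k) ∧
      (∀ k ≤ 4,
            (fun k => if k = 0 then 0 else
              (if k ≤ 3 then klC1TableF8192.bound (fun l : ℕ => if l = 0 then π / 2 * cc 1 * (4 : ℝ) ^ ((((1 : ℕ) : ℤ) - 2) * ((3 : ℕ) : ℤ)) else cc l * (4 : ℝ) ^ (((l : ℤ) - 2) * ((3 : ℕ) : ℤ))) k
                else klC1TableF8192.boundNR (fun l : ℕ => if l = 0 then π / 2 * cc 1 * (4 : ℝ) ^ ((((1 : ℕ) : ℤ) - 2) * ((3 : ℕ) : ℤ)) else cc l * (4 : ℝ) ^ (((l : ℤ) - 2) * ((3 : ℕ) : ℤ))) k) *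
                ((4 : ℝ) ^ (((k : ℤ) - 2) * ((3 + 1 : ℕ) : ℤ)))⁻¹) k ≤ eJ 3 k) ∧
      (∀ k ≤ 4,
            (fun k => if k = 0 then 0 else
              (if k ≤ 3 then klC1TableF32768.bound (fun l : ℕ => if l = 0 then π / 2 * cc 1 * (4 : ℝ) ^ ((((1 : ℕ) : ℤ) - 2) * ((4 : ℕ) : ℤ)) else cc l * (4 : ℝ) ^ (((l : ℤ) - 2) * ((4 : ℕ) : ℤ))) k
                else klC1TableF32768.boundNR (fun l : ℕ => if l = 0 then π / 2 * cc 1 * (4 : ℝ) ^ ((((1 : ℕ) : ℤ) - 2) * ((4 : ℕ) : ℤ)) else cc l * (4 : ℝ) ^ (((l : ℤ) - 2) * ((4 : ℕ) : ℤ))) k) *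
                ((4 : ℝ) ^ (((k : ℤ) - 2) * ((4 + 1 : ℕ) : ℤ)))⁻¹) k ≤ eJ 4 k) ∧
      -- (iii) the private fits at the table scales m ≤ 4 (hres‴ l.111 shape `cA m k + (FIT·U₀ + eJ m k) ≤ cc k`, FIT share abstracted as `t k ≤ 2⁻¹⁰`)
      (∀ m ≤ 4, ∀ k, 1 ≤ k → k ≤ 4 → cA m k + (t k + eJ m k) ≤ cc k) ∧
      -- (iv) the deep fits, 5 ≤ m (hres‴ l.114 shape, analytic branch `klC1AnFit cc`)
      (∀ m, 5 ≤ m → ∀ k, 1 ≤ k → k ≤ 4 → cA m k + (t k + klC1AnFit cc k) ≤ cc k) ∧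
      -- (v) dominations and ceilings
      (∀ k, 1 ≤ k → k ≤ 4 → c0 k ≤ cc k ∧ cc k ≤ klC4aJetC2 k) := by
  have hcc : ∀ l, 0 ≤ (fun k : ℕ => if k = 1 then (8 : ℝ) else if k = 2 then 16 else if k = 3 then 16 else if k = 4 then 2048 else c0 k) l := by
    intro l
    have := hc0 l
    dsimp only
    split_ifs <;> linarith [this]
  -- private table `cc⋆ = (·, 8, 16, 16, 2048)`; `eJ 0` = the `d = 128` upper forms on `c0` (k3c3-p1), `eJ m` (`m ≥ 1`) = ONE numeric row above all four
  -- `d = 512 … 32768` upper forms at `cc⋆` (values (0.633, 0.273, 4.68, 275.9) / (1.043, 0.290, 8.065, 257.1) / (0.687, 0.176, 5.45, 256.4) / (1.011, 0.255, 8.074, 256.4))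
  refine ⟨fun k => if k = 1 then 8 else if k = 2 then 16 else if k = 3 then 16 else if k = 4 then 2048 else c0 k,
    fun m k => if m = 0 then
        (if k = 1 then 0.8105 * c0 1 + 0.02273 * c0 2 else if k = 2 then 2.061 * c0 1 + 0.04792 * c0 2 + 0.005681 * c0 3
          else if k = 3 then 45.82 * c0 1 + 0.09241 * c0 2 + 0.01341 * c0 3 + 0.001421 * c0 4
          else if k = 4 then 5928 * c0 1 + 0.4898 * c0 2 + 0.03347 * c0 3 + 0.1289 * c0 4 else 0)
      else (if k = 1 then 1.05 else if k = 2 then 0.29 else if k = 3 then 8.08 else if k = 4 then 276 else 0),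
    hcc, ?_, ?_, ?_, ?_, ?_, ?_, ?_, ?_, ?_⟩
  · -- eJ m 0 = 0
    intro m
    dsimp only
    split_ifs <;> simp_all
  · -- (i) m = 0 on c0: k3c3-p1's upper numerals `klC1TableF128r_eJ_le`, row by row
    intro k hk
    refine (klC1TableF128r_eJ_le hc0 k hk).trans (le_of_eq ?_)
    interval_cases k <;> norm_num
  · -- (ii) m = 1, d = 512
    intro k hk
    refine (klC1TableF512_eJ_le hcc k hk).trans ?_
    interval_cases k <;> norm_num
  · -- m = 2, d = 2048
    intro k hk
    refine (klC1TableF2048_eJ_le hcc k hk).trans ?_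
    interval_cases k <;> norm_num
  · -- m = 3, d = 8192
    intro k hk
    refine (klC1TableF8192_eJ_le hcc k hk).trans ?_
    interval_cases k <;> norm_num
  · -- m = 4, d = 32768
    intro k hk
    refine (klC1TableF32768_eJ_le hcc k hk).trans ?_
    interval_cases k <;> norm_num
  · -- (iii) fits at m ≤ 4
    intro m hm k hk1 hk4
    obtain ⟨a1, a2, a3, a4⟩ := ha m
    have tk := ht' k
    have c1 := hc0 1; have c2 := hc0 2; have c3 := hc0 3; have c4 := hc0 4
    rcases Nat.eq_zero_or_pos m with rfl | hm1
    · interval_cases k <;> norm_num at h1 h2 h3 h4 tk ⊢ <;> linarith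
    · have hm0 : m ≠ 0 := Nat.pos_iff_ne_zero.mp hm1
      interval_cases k <;> norm_num [hm0] at a1 a2 a3 a4 tk ⊢ <;> linarith
  · -- (iv) deep fits
    intro m hm k hk1 hk4
    obtain ⟨a1, a2, a3, a4⟩ := ha m
    have tk := ht' k
    interval_cases k <;> norm_num [klC1AnFit] at a1 a2 a3 a4 tk ⊢ <;> linarith
  · -- (v) dominations and ceilings
    intro k hk1 hk4
    have d1 := hc01; have d2 := hc02; have d3 := hc03; have d4 := hc04
    interval_cases k
    · exact ⟨by simpa using d1, by norm_num⟩
    · exact ⟨by simpa using d2, by norm_num⟩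
    · exact ⟨by simpa using d3, by norm_num⟩
    · exact ⟨by simpa using d4, by norm_num⟩

/-! ## §2 Box forms in the record currency -/

/-- **THE SCREEN IN THE RECORD CURRENCY, EVERYTHING ELSE AT ITS CEILING**: for every dedicated table with `c0 1 ≤ 0.18` and `c0 2 ≤ 16`, `c0 3 ≤ 16`,
`c0 4 ≤ 2048` (the #22a `k = 2` and #22b `k = 3, 4` fit ceilings `klC4aJetC2 2/3/4` of ✓ …ScaleZeroRecordPairWindow — so ANY `(B₂, sS₃, sS₄)` the
registered scale-`0` producer accepts), every slice row `≤ (6, 9.1, 3, 220)` at every scale and `t ≤ 2⁻¹⁰`, the fit block of `hres‴` is satisfiable at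
`cc⋆ = (·, 8, 16, 16, 2048)` across all scales.  In #22a's currency: **`bS 1 ≤ B₁ ≤ (0.18 − δ_A)/3.19 = 0.0564…` suffices** (spec target of record `0.16` ✗;
certified (a1) sub-disk pilot at `μ*`: near `0.0436`; float full zone I `≈ 0.048` + far budget). [cite: BenfattoGiulianiMastropietro2006, §2.4 Lemma 2.1 (2.36)–(2.42)] -/
theorem firstStep_dedicated_allScales_feasible_recordBox {c0 t : ℕ → ℝ} {cA : ℕ → ℕ → ℝ} (hc0 : ∀ l, 0 ≤ c0 l)
    (hc01 : c0 1 ≤ 0.18) (hc02 : c0 2 ≤ 16) (hc03 : c0 3 ≤ 16) (hc04 : c0 4 ≤ 2048)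
    (ha : ∀ m, cA m 1 ≤ 6 ∧ cA m 2 ≤ 9.1 ∧ cA m 3 ≤ 3 ∧ cA m 4 ≤ 220) (ht' : ∀ k, t k ≤ 1 / 2 ^ 10) :
    ∃ cc : ℕ → ℝ, ∃ eJ : ℕ → ℕ → ℝ, (∀ l, 0 ≤ cc l) ∧ (∀ m, eJ m 0 = 0) ∧
      (∀ k ≤ 4,
            (fun k => if k = 0 then 0 else
              (if k ≤ 3 then klC1TableF128r.bound (fun l : ℕ => if l = 0 then π / 2 * c0 1 * (4 : ℝ) ^ ((((1 : ℕ) : ℤ) - 2) * ((0 : ℕ) : ℤ)) else c0 l * (4 : ℝ) ^ (((l : ℤ) - 2) * ((0 : ℕ) : ℤ))) k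
                else klC1TableF128r.boundNR (fun l : ℕ => if l = 0 then π / 2 * c0 1 * (4 : ℝ) ^ ((((1 : ℕ) : ℤ) - 2) * ((0 : ℕ) : ℤ)) else c0 l * (4 : ℝ) ^ (((l : ℤ) - 2) * ((0 : ℕ) : ℤ))) k) *
                ((4 : ℝ) ^ (((k : ℤ) - 2) * ((0 + 1 : ℕ) : ℤ)))⁻¹) k ≤ eJ 0 k) ∧
      (∀ k ≤ 4,
            (fun k => if k = 0 then 0 else
              (if k ≤ 3 then klC1TableF512.bound (fun l : ℕ => if l = 0 then π / 2 * cc 1 * (4 : ℝ) ^ ((((1 : ℕ) : ℤ) - 2) * ((1 : ℕ) : ℤ)) else cc l * (4 : ℝ) ^ (((l : ℤ) - 2) * ((1 : ℕ) : ℤ))) k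
                else klC1TableF512.boundNR (fun l : ℕ => if l = 0 then π / 2 * cc 1 * (4 : ℝ) ^ ((((1 : ℕ) : ℤ) - 2) * ((1 : ℕ) : ℤ)) else cc l * (4 : ℝ) ^ (((l : ℤ) - 2) * ((1 : ℕ) : ℤ))) k) *
                ((4 : ℝ) ^ (((k : ℤ) - 2) * ((1 + 1 : ℕ) : ℤ)))⁻¹) k ≤ eJ 1 k) ∧
      (∀ k ≤ 4,
            (fun k => if k = 0 then 0 else
              (if k ≤ 3 then klC1TableF2048.bound (fun l : ℕ => if l = 0 then π / 2 * cc 1 * (4 : ℝ) ^ ((((1 : ℕ) : ℤ) - 2) * ((2 : ℕ) : ℤ)) else cc l * (4 : ℝ) ^ (((l : ℤ) - 2) * ((2 : ℕ) : ℤ))) k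
                else klC1TableF2048.boundNR (fun l : ℕ => if l = 0 then π / 2 * cc 1 * (4 : ℝ) ^ ((((1 : ℕ) : ℤ) - 2) * ((2 : ℕ) : ℤ)) else cc l * (4 : ℝ) ^ (((l : ℤ) - 2) * ((2 : ℕ) : ℤ))) k) *
                ((4 : ℝ) ^ (((k : ℤ) - 2) * ((2 + 1 : ℕ) : ℤ)))⁻¹) k ≤ eJ 2 k) ∧
      (∀ k ≤ 4,
            (fun k => if k = 0 then 0 else
              (if k ≤ 3 then klC1TableF8192.bound (fun l : ℕ => if l = 0 then π / 2 * cc 1 * (4 : ℝ) ^ ((((1 : ℕ) : ℤ) - 2) * ((3 : ℕ) : ℤ)) else cc l * (4 : ℝ) ^ (((l : ℤ) - 2) * ((3 : ℕ) : ℤ))) k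
                else klC1TableF8192.boundNR (fun l : ℕ => if l = 0 then π / 2 * cc 1 * (4 : ℝ) ^ ((((1 : ℕ) : ℤ) - 2) * ((3 : ℕ) : ℤ)) else cc l * (4 : ℝ) ^ (((l : ℤ) - 2) * ((3 : ℕ) : ℤ))) k) *
                ((4 : ℝ) ^ (((k : ℤ) - 2) * ((3 + 1 : ℕ) : ℤ)))⁻¹) k ≤ eJ 3 k) ∧
      (∀ k ≤ 4,
            (fun k => if k = 0 then 0 else
              (if k ≤ 3 then klC1TableF32768.bound (fun l : ℕ => if l = 0 then π / 2 * cc 1 * (4 : ℝ) ^ ((((1 : ℕ) : ℤ) - 2) * ((4 : ℕ) : ℤ)) else cc l * (4 : ℝ) ^ (((l : ℤ) - 2) * ((4 : ℕ) : ℤ))) k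
                else klC1TableF32768.boundNR (fun l : ℕ => if l = 0 then π / 2 * cc 1 * (4 : ℝ) ^ ((((1 : ℕ) : ℤ) - 2) * ((4 : ℕ) : ℤ)) else cc l * (4 : ℝ) ^ (((l : ℤ) - 2) * ((4 : ℕ) : ℤ))) k) *
                ((4 : ℝ) ^ (((k : ℤ) - 2) * ((4 + 1 : ℕ) : ℤ)))⁻¹) k ≤ eJ 4 k) ∧
      (∀ m ≤ 4, ∀ k, 1 ≤ k → k ≤ 4 → cA m k + (t k + eJ m k) ≤ cc k) ∧
      (∀ m, 5 ≤ m → ∀ k, 1 ≤ k → k ≤ 4 → cA m k + (t k + klC1AnFit cc k) ≤ cc k) ∧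
      (∀ k, 1 ≤ k → k ≤ 4 → c0 k ≤ cc k ∧ cc k ≤ klC4aJetC2 k) := by
  obtain ⟨a1, a2, a3, a4⟩ := ha 0
  have c1 := hc0 1; have c2 := hc0 2; have c3 := hc0 3; have c4 := hc0 4
  exact firstStep_dedicated_allScales_feasible_of_rows hc0 (by linarith) hc02 hc03 hc04 ha ht'
    (by norm_num at hc01 a2 ⊢; linarith) (by norm_num at hc01 a2 ⊢; linarith) (by norm_num at hc01 ⊢; linarith) (by norm_num at hc01 ⊢; linarith)

/-- **THE SAME SCREEN WITH THE HONEST SIGNED `k = 3` SLICE** (`cA m 3 ≤ 0.25`, (R559)/(R561): C4A-PLAN's `(6, 9.1, 3, 220)` was the inflated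
`|·|`-currency; the signed row of record is `(0.007, 0.034, 0.23, 3)`): the box extends to `c0 1 ≤ 0.24`, i.e. **`B₁ ≤ (0.24 − δ_A)/3.19 = 0.0752…`**,
still with `c0 2, c0 3, c0 4` at their ceilings. [cite: BenfattoGiulianiMastropietro2006, §2.4 Lemma 2.1 (2.36)–(2.42)] -/
theorem firstStep_dedicated_allScales_feasible_recordBox_signedA {c0 t : ℕ → ℝ} {cA : ℕ → ℕ → ℝ} (hc0 : ∀ l, 0 ≤ c0 l)
    (hc01 : c0 1 ≤ 0.24) (hc02 : c0 2 ≤ 16) (hc03 : c0 3 ≤ 16) (hc04 : c0 4 ≤ 2048)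
    (ha : ∀ m, cA m 1 ≤ 6 ∧ cA m 2 ≤ 9.1 ∧ cA m 3 ≤ 0.25 ∧ cA m 4 ≤ 220) (ht' : ∀ k, t k ≤ 1 / 2 ^ 10) :
    ∃ cc : ℕ → ℝ, ∃ eJ : ℕ → ℕ → ℝ, (∀ l, 0 ≤ cc l) ∧ (∀ m, eJ m 0 = 0) ∧
      (∀ k ≤ 4,
            (fun k => if k = 0 then 0 else
              (if k ≤ 3 then klC1TableF128r.bound (fun l : ℕ => if l = 0 then π / 2 * c0 1 * (4 : ℝ) ^ ((((1 : ℕ) : ℤ) - 2) * ((0 : ℕ) : ℤ)) else c0 l * (4 : ℝ) ^ (((l : ℤ) - 2) * ((0 : ℕ) : ℤ))) k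
                else klC1TableF128r.boundNR (fun l : ℕ => if l = 0 then π / 2 * c0 1 * (4 : ℝ) ^ ((((1 : ℕ) : ℤ) - 2) * ((0 : ℕ) : ℤ)) else c0 l * (4 : ℝ) ^ (((l : ℤ) - 2) * ((0 : ℕ) : ℤ))) k) *
                ((4 : ℝ) ^ (((k : ℤ) - 2) * ((0 + 1 : ℕ) : ℤ)))⁻¹) k ≤ eJ 0 k) ∧
      (∀ k ≤ 4,
            (fun k => if k = 0 then 0 else
              (if k ≤ 3 then klC1TableF512.bound (fun l : ℕ => if l = 0 then π / 2 * cc 1 * (4 : ℝ) ^ ((((1 : ℕ) : ℤ) - 2) * ((1 : ℕ) : ℤ)) else cc l * (4 : ℝ) ^ (((l : ℤ) - 2) * ((1 : ℕ) : ℤ))) k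
                else klC1TableF512.boundNR (fun l : ℕ => if l = 0 then π / 2 * cc 1 * (4 : ℝ) ^ ((((1 : ℕ) : ℤ) - 2) * ((1 : ℕ) : ℤ)) else cc l * (4 : ℝ) ^ (((l : ℤ) - 2) * ((1 : ℕ) : ℤ))) k) *
                ((4 : ℝ) ^ (((k : ℤ) - 2) * ((1 + 1 : ℕ) : ℤ)))⁻¹) k ≤ eJ 1 k) ∧
      (∀ k ≤ 4,
            (fun k => if k = 0 then 0 else
              (if k ≤ 3 then klC1TableF2048.bound (fun l : ℕ => if l = 0 then π / 2 * cc 1 * (4 : ℝ) ^ ((((1 : ℕ) : ℤ) - 2) * ((2 : ℕ) : ℤ)) else cc l * (4 : ℝ) ^ (((l : ℤ) - 2) * ((2 : ℕ) : ℤ))) k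
                else klC1TableF2048.boundNR (fun l : ℕ => if l = 0 then π / 2 * cc 1 * (4 : ℝ) ^ ((((1 : ℕ) : ℤ) - 2) * ((2 : ℕ) : ℤ)) else cc l * (4 : ℝ) ^ (((l : ℤ) - 2) * ((2 : ℕ) : ℤ))) k) *
                ((4 : ℝ) ^ (((k : ℤ) - 2) * ((2 + 1 : ℕ) : ℤ)))⁻¹) k ≤ eJ 2 k) ∧
      (∀ k ≤ 4,
            (fun k => if k = 0 then 0 else
              (if k ≤ 3 then klC1TableF8192.bound (fun l : ℕ => if l = 0 then π / 2 * cc 1 * (4 : ℝ) ^ ((((1 : ℕ) : ℤ) - 2) * ((3 : ℕ) : ℤ)) else cc l * (4 : ℝ) ^ (((l : ℤ) - 2) * ((3 : ℕ) : ℤ))) k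
                else klC1TableF8192.boundNR (fun l : ℕ => if l = 0 then π / 2 * cc 1 * (4 : ℝ) ^ ((((1 : ℕ) : ℤ) - 2) * ((3 : ℕ) : ℤ)) else cc l * (4 : ℝ) ^ (((l : ℤ) - 2) * ((3 : ℕ) : ℤ))) k) *
                ((4 : ℝ) ^ (((k : ℤ) - 2) * ((3 + 1 : ℕ) : ℤ)))⁻¹) k ≤ eJ 3 k) ∧
      (∀ k ≤ 4,
            (fun k => if k = 0 then 0 else
              (if k ≤ 3 then klC1TableF32768.bound (fun l : ℕ => if l = 0 then π / 2 * cc 1 * (4 : ℝ) ^ ((((1 : ℕ) : ℤ) - 2) * ((4 : ℕ) : ℤ)) else cc l * (4 : ℝ) ^ (((l : ℤ) - 2) * ((4 : ℕ) : ℤ))) k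
                else klC1TableF32768.boundNR (fun l : ℕ => if l = 0 then π / 2 * cc 1 * (4 : ℝ) ^ ((((1 : ℕ) : ℤ) - 2) * ((4 : ℕ) : ℤ)) else cc l * (4 : ℝ) ^ (((l : ℤ) - 2) * ((4 : ℕ) : ℤ))) k) *
                ((4 : ℝ) ^ (((k : ℤ) - 2) * ((4 + 1 : ℕ) : ℤ)))⁻¹) k ≤ eJ 4 k) ∧
      (∀ m ≤ 4, ∀ k, 1 ≤ k → k ≤ 4 → cA m k + (t k + eJ m k) ≤ cc k) ∧
      (∀ m, 5 ≤ m → ∀ k, 1 ≤ k → k ≤ 4 → cA m k + (t k + klC1AnFit cc k) ≤ cc k) ∧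
      (∀ k, 1 ≤ k → k ≤ 4 → c0 k ≤ cc k ∧ cc k ≤ klC4aJetC2 k) := by
  obtain ⟨a1, a2, a3, a4⟩ := ha 0
  have c1 := hc0 1; have c2 := hc0 2; have c3 := hc0 3; have c4 := hc0 4
  have ha' : ∀ m, cA m 1 ≤ 6 ∧ cA m 2 ≤ 9.1 ∧ cA m 3 ≤ 3 ∧ cA m 4 ≤ 220 := fun m => by
    obtain ⟨b1, b2, b3, b4⟩ := ha m
    exact ⟨b1, b2, by norm_num at b3 ⊢; linarith, b4⟩
  exact firstStep_dedicated_allScales_feasible_of_rows hc0 (by norm_num at hc01 ⊢; linarith) hc02 hc03 hc04 ha' ht'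
    (by norm_num at hc01 a2 ⊢; linarith) (by norm_num at hc01 a2 ⊢; linarith) (by norm_num at hc01 a3 ⊢; linarith) (by norm_num at hc01 ⊢; linarith)

end Summit.HubbardSuperconductivity.HubbardSuperconductivity.Theorems.EngineV8

end
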